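import Summits.CriticalPhenomena.Ising3DConformalLimit.Theorems.EnergyNotSigmaSquaredGapForcesFarMergingFloorsReduction
import Summits.CriticalPhenomena.Ising3DConformalLimit.Theorems.EnergyNotSigmaSquaredGapForcesFarMergingRootOpacityScreen

/-! # Floors ⇒ separation under the screening tilt, event form (the Markov converse)
(line `screening-form-lemma-a1` of crux `GapForcesFarMerging`, item stmt-CriticalPhenomena-4468;
helper file of the open stub `stub_floors`)

The landed reduction `floors_of_separation` (file `…FloorsReduction.lean`) derives the currency `Floors`
(octave floor `δ·A(2^j;m) ≤ A(2^{j+1};m)` and bulk floor `δ·A(2^k;m) ≤ A(n;m)` of the one-pinch screening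
ladder `A(r;m) = pinchScreen n r m = E[sw_r]`, `sw_r = 𝟙[e₂,dn m ∉ C]·S(C_r)`) from the SEPARATION EVENT
under the screening tilt, `c·A(r;m) ≤ E[𝟙{c·sw_r ≤ sw_{r'}}·sw_r]`. This file proves the CONVERSE, making
that currency exact: `Floors` implies the separation event form with `c = δ/2`. The one piece of
mathematics is the POINTWISE ANTITONICITY of the screening functional in the exploration radius,
`sw_{r'} ≤ sw_r` for `r ≤ r'` (the explored cluster `C_r(0)` grows with `r` — `openClusterIn` is monotone in
the step graph, `box` is monotone — and the screening ratio `S_{ab}(T) = ⟨σ_aσ_b⟩_{Λ_n∖T}/⟨σ_aσ_b⟩_{Λ_n}` is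
antitone in the obstacle `T` by Griffiths II, `isingCorr_free_le_of_subset`); then
`δ·E[sw_r] ≤ E[sw_{r'}] ≤ E[sw_r·𝟙{c·sw_r ≤ sw_{r'}}] + c·E[sw_r]` (split over the event and its complement),
i.e. `(δ - c)·A(r;m) ≤ E[𝟙{c·sw_r ≤ sw_{r'}}·sw_r]`.
References: Lawler 1991 ch. 3 (separation lemma: the template); ADC21 (arXiv:1912.07973) App. A Lemma A.1;
Friedli–Velenik 2017 Exercise 3.12 (Griffiths monotonicity in the volume). -/

noncomputable section

namespace Summit.CriticalPhenomena.Ising3DConformalLimit.EnergyNotSigmaSquaredGapForcesFarMerging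

open scoped symmDiff ENNReal
open MeasureTheory Filter Finset
open Literature.Probability.LatticeModels Literature.Probability.Percolation
open Summit.CriticalPhenomena.Ising3DConformalLimit.Theorems.GapForcesFarMerging.Negative (e₁ e₂ cc2 xR up dn)
open Summit.CriticalPhenomena.Ising3DConformalLimit.GapForcesFarMergingScreening

/-! ### Pointwise antitonicity of the screening functional in the exploration radius -/

/-- The explored cluster grows with the radius: `C_r(o) ⊆ C_{r'}(o)` for `r ≤ r'` (`Λ_r ⊆ Λ_{r'}`, and the
step graph inside `Λ_r` is a subgraph of the step graph inside `Λ_{r'}`). [folklore] -/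
theorem floorsNec_innerCluster_mono {r r' : ℕ} (h : r ≤ r') (o : Site 3) (ω : BondConfig (Site 3)) :
    innerCluster r o ω ⊆ innerCluster r' o ω := by
  classical
  intro v hv
  unfold innerCluster at hv ⊢
  rw [Finset.mem_filter] at hv ⊢
  exact ⟨box_mono 3 h hv.1,
    openClusterIn_mono_graph (withinGraph_mono _ (Finset.coe_subset.2 (box_mono 3 h))) ω o hv.2⟩

/-- **Griffiths antitonicity of the screening ratio in the obstacle**: for `T ⊆ T'` and probe points
`a, b ∈ Λ_n ∖ T'`, `S⁽ⁿ⁾_{ab}(T') ≤ S⁽ⁿ⁾_{ab}(T)` (the numerator `⟨σ_aσ_b⟩_{Λ_n∖T'}` is monotone in the free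
region, GKS II; the denominator `⟨σ_aσ_b⟩_{Λ_n} ≥ 0`, GKS I). [cite: FriedliVelenik2017, Exercise 3.12] -/
theorem floorsNec_screening_anti {n : ℕ} {T T' : Finset (Site 3)} (hT : T ⊆ T') {a b : Site 3}
    (ha : a ∈ box 3 n \ T') (hb : b ∈ box 3 n \ T') : screening n T' a b ≤ screening n T a b := by
  have hβ : 0 < criticalBeta 3 := criticalBeta_pos_holds (d := 3) (by norm_num)
  have han : a ∈ box 3 n := (Finset.mem_sdiff.1 ha).1
  have hbn : b ∈ box 3 n := (Finset.mem_sdiff.1 hb).1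
  unfold screening boxTwoPoint
  rw [isingTwoPoint_free_eq_isingCorr_symmDiff, isingTwoPoint_free_eq_isingCorr_symmDiff,
    isingTwoPoint_free_eq_isingCorr_symmDiff, Finset.sdiff_empty]
  refine div_le_div_of_nonneg_right ?_
    (GKSInequalities.gks_one_holds _ hβ.le le_rfl (Or.inl rfl) (pair_symmDiff_subset han hbn))
  exact isingCorr_free_le_of_subset _ hβ.le le_rfl (pair_symmDiff_subset ha hb)
    (Finset.sdiff_subset_sdiff le_rfl hT)

/-- **Pointwise antitonicity of the screening functional in the radius**: for `r ≤ r'` and probe points in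
the box, `screenWeight n r' 0 e₂ (dn m) ω ≤ screenWeight n r 0 e₂ (dn m) ω` (both vanish when a probe point is
swallowed by the full cluster; otherwise the probe points lie off `C_{r'}(0) ⊇ C_r(0)` and Griffiths applies).
[cite: AizenmanDuminilCopinAnnals2021, Appendix A, Corollary A.2] -/
theorem floorsNec_screenWeight_anti {n r r' m : ℕ} (h : r ≤ r') (he : (e₂ : Site 3) ∈ box 3 n)
    (hd : dn m ∈ box 3 n) (ω : BondConfig (Site 3)) :
    screenWeight n r' 0 e₂ (dn m) ω ≤ screenWeight n r 0 e₂ (dn m) ω := by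
  unfold screenWeight
  split_ifs with hc
  · exact le_rfl
  · push Not at hc
    exact floorsNec_screening_anti (floorsNec_innerCluster_mono h 0 ω)
      (Finset.mem_sdiff.2 ⟨he, fun h' => hc.1 (innerCluster_subset_openCluster r' 0 ω _ h')⟩)
      (Finset.mem_sdiff.2 ⟨hd, fun h' => hc.2 (innerCluster_subset_openCluster r' 0 ω _ h')⟩)

/-- **The ladder is antitone in the exploration radius**: `A(r';m) ≤ A(r;m)` for `r ≤ r'` once the probe
points and the far source lie in `Λ_n` (pointwise antitonicity integrated against the box law). In particular
the constant of `Floors` is at most `1`. [cite: AizenmanDuminilCopinAnnals2021, Appendix A, Corollary A.2] -/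
theorem floorsNec_pinchScreen_anti {n r r' m : ℕ} (h : r ≤ r') (hup : up m ∈ box 3 n)
    (he : (e₂ : Site 3) ∈ box 3 n) (hd : dn m ∈ box 3 n) : pinchScreen n r' m ≤ pinchScreen n r m := by
  haveI := floorsRed_isProbabilityMeasure (n := n) hup
  exact integral_mono (floorsRed_integrable _ (floorsRed_abs_screenWeight_le n r' 0 e₂ (dn m)))
    (floorsRed_integrable _ (floorsRed_abs_screenWeight_le n r 0 e₂ (dn m)))
    fun ω => floorsNec_screenWeight_anti h he hd ω

/-! ### The Markov converse at fixed radii -/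

/-- **Markov converse at fixed radii**: if `δ·A(r;m) ≤ A(r';m)` with `r ≤ r'`, `δ ≥ 0` (probe points and far
source in `Λ_n`), then `(δ/2)·A(r;m) ≤ E[𝟙{(δ/2)·sw_r ≤ sw_{r'}}·sw_r]`: split `E[sw_{r'}]` over the event and
its complement, use `sw_{r'} ≤ sw_r` on the event and `sw_{r'} < (δ/2)·sw_r` off it. [cite: Lawler1991, Ch. 3] -/
theorem floorsNec_step {n r r' m : ℕ} {δ : ℝ} (hδ : 0 ≤ δ) (hrr' : r ≤ r') (hup : up m ∈ box 3 n)
    (he₂ : (e₂ : Site 3) ∈ box 3 n) (hdn : dn m ∈ box 3 n)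
    (h : δ * pinchScreen n r m ≤ pinchScreen n r' m) :
    δ / 2 * pinchScreen n r m ≤
      ∫ ω, (if δ / 2 * screenWeight n r 0 e₂ (dn m) ω ≤ screenWeight n r' 0 e₂ (dn m) ω
          then screenWeight n r 0 e₂ (dn m) ω else 0)
        ∂(sourcedDoubleCurrentLaw 3 n (criticalBeta 3) ({0} ∆ {up m}) ∅) := by
  haveI := floorsRed_isProbabilityMeasure (n := n) hup
  -- integrability of the three bounded functionals
  have hf_int : Integrable (fun ω => screenWeight n r 0 e₂ (dn m) ω)
      (sourcedDoubleCurrentLaw 3 n (criticalBeta 3) ({0} ∆ {up m}) ∅) :=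
    floorsRed_integrable _ (floorsRed_abs_screenWeight_le n r 0 e₂ (dn m))
  have hg_int : Integrable (fun ω => screenWeight n r' 0 e₂ (dn m) ω)
      (sourcedDoubleCurrentLaw 3 n (criticalBeta 3) ({0} ∆ {up m}) ∅) :=
    floorsRed_integrable _ (floorsRed_abs_screenWeight_le n r' 0 e₂ (dn m))
  have hF_int : Integrable (fun ω =>
      (if δ / 2 * screenWeight n r 0 e₂ (dn m) ω ≤ screenWeight n r' 0 e₂ (dn m) ω
        then screenWeight n r 0 e₂ (dn m) ω else 0))
      (sourcedDoubleCurrentLaw 3 n (criticalBeta 3) ({0} ∆ {up m}) ∅) := by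
    refine floorsRed_integrable (|boxTwoPoint n ∅ e₂ (dn m)|⁻¹) fun ω => ?_
    split_ifs
    · exact floorsRed_abs_screenWeight_le n r 0 e₂ (dn m) ω
    · rw [abs_zero]; exact inv_nonneg.2 (abs_nonneg _)
  -- pointwise: `sw_{r'} ≤ 𝟙{(δ/2)·sw_r ≤ sw_{r'}}·sw_r + (δ/2)·sw_r`
  have hpt : ∀ ω, screenWeight n r' 0 e₂ (dn m) ω ≤
      (if δ / 2 * screenWeight n r 0 e₂ (dn m) ω ≤ screenWeight n r' 0 e₂ (dn m) ω
        then screenWeight n r 0 e₂ (dn m) ω else 0) + δ / 2 * screenWeight n r 0 e₂ (dn m) ω := fun ω => by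
    have hgf := floorsNec_screenWeight_anti hrr' he₂ hdn ω
    have hf0 := floorsRed_screenWeight_nonneg (r := r) (o := 0) he₂ hdn ω
    split_ifs with hle
    · nlinarith
    · push Not at hle
      linarith
  have hmono : ∫ ω, screenWeight n r' 0 e₂ (dn m) ω ∂(sourcedDoubleCurrentLaw 3 n (criticalBeta 3) ({0} ∆ {up m}) ∅) ≤
      ∫ ω, ((if δ / 2 * screenWeight n r 0 e₂ (dn m) ω ≤ screenWeight n r' 0 e₂ (dn m) ω
        then screenWeight n r 0 e₂ (dn m) ω else 0) + δ / 2 * screenWeight n r 0 e₂ (dn m) ω)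
        ∂(sourcedDoubleCurrentLaw 3 n (criticalBeta 3) ({0} ∆ {up m}) ∅) :=
    integral_mono hg_int (hF_int.fun_add (hf_int.const_mul (δ / 2))) hpt
  rw [integral_add hF_int (hf_int.const_mul _), integral_const_mul] at hmono
  -- `δ·A(r) ≤ A(r') ≤ ∫ F + (δ/2)·A(r)`
  have hA : pinchScreen n r m =
      ∫ ω, screenWeight n r 0 e₂ (dn m) ω ∂(sourcedDoubleCurrentLaw 3 n (criticalBeta 3) ({0} ∆ {up m}) ∅) :=
    rfl
  have hA' : pinchScreen n r' m =
      ∫ ω, screenWeight n r' 0 e₂ (dn m) ω ∂(sourcedDoubleCurrentLaw 3 n (criticalBeta 3) ({0} ∆ {up m}) ∅) :=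
    rfl
  rw [hA, hA'] at h
  rw [hA]
  linarith

/-! ### The registered necessity theorem -/

/-- **FLOORS ⇒ SEPARATION UNDER THE SCREENING TILT (event form)** — the Markov converse of the landed
`floors_of_separation`, registered helper of the open stub `stub_floors`: if the one-pinch screening ladder has
octave floors `δ·A(2^j;m) ≤ A(2^{j+1};m)` (`j ≥ j₀`, `m ≥ 2^{j+4}`, large `n`) and bulk floors
`δ·A(2^k;m) ≤ A(n;m)` (`2^{k+3} ≤ m < 2^{k+4}`, large `n`), then with `c = δ/2` the box law tilted by
`sw_r = 𝟙[e₂,dn m ∉ C]·S(C_r)` charges the separation event `{c·sw_r ≤ sw_{r'}}` with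
`c·A(r;m) ≤ E[𝟙{c·sw_r ≤ sw_{r'}}·sw_r]`, in both the octave (`r' = 2r = 2^{j+1}`) and the bulk (`r' = n`)
geometry. Together with `floors_of_separation` this makes the separation event form an EXACT currency for
`Floors` (up to `c ↦ c²`). [cite: Lawler1991, Ch. 3] -/
theorem separation_of_floors : Floors → ∃ c : ℝ, 0 < c ∧ (∀ᶠ j : ℕ in atTop, ∀ m : ℕ, 2 ^ (j + 4) ≤ m → ∀ᶠ n : ℕ in atTop, c * pinchScreen n (2 ^ j) m ≤ ∫ ω, (if c * screenWeight n (2 ^ j) 0 e₂ (dn m) ω ≤ screenWeight n (2 ^ (j + 1)) 0 e₂ (dn m) ω then screenWeight n (2 ^ j) 0 e₂ (dn m) ω else 0) ∂(sourcedDoubleCurrentLaw 3 n (criticalBeta 3) ({0} ∆ {up m}) ∅)) ∧ (∀ᶠ k : ℕ in atTop, ∀ m : ℕ, 2 ^ (k + 3) ≤ m → m < 2 ^ (k + 4) → ∀ᶠ n : ℕ in atTop, c * pinchScreen n (2 ^ k) m ≤ ∫ ω, (if c * screenWeight n (2 ^ k) 0 e₂ (dn m) ω ≤ screenWeight n n 0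 e₂ (dn m) ω then screenWeight n (2 ^ k) 0 e₂ (dn m) ω else 0) ∂(sourcedDoubleCurrentLaw 3 n (criticalBeta 3) ({0} ∆ {up m}) ∅)) := by
  rintro ⟨δ, hδ, hoct, hbulk⟩
  refine ⟨δ / 2, half_pos hδ, ?_, ?_⟩
  · filter_upwards [hoct] with j hj m hm
    filter_upwards [hj m hm, floorsRed_eventually_mem_box m] with n hn hbox
    exact floorsNec_step hδ.le (Nat.pow_le_pow_right two_pos (Nat.le_succ j)) hbox.1 hbox.2.1 hbox.2.2 hn
  · filter_upwards [hbulk] with k hk m hm hm'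
    filter_upwards [hk m hm hm', floorsRed_eventually_mem_box m, eventually_ge_atTop (2 ^ k)] with n hn hbox hkn
    exact floorsNec_step hδ.le hkn hbox.1 hbox.2.1 hbox.2.2 hn

end Summit.CriticalPhenomena.Ising3DConformalLimit.EnergyNotSigmaSquaredGapForcesFarMerging

end
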